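import Literature.AlgebraicGeometry.Resolution.PointBlowupShade
import Literature.AlgebraicGeometry.Resolution.HasseSchmidtDerivatives

/-!
# Villamayor's elimination algebra on the point-blowup walk (statement-level typing)

`PointBlowupShade` types Hauser's walk for `x^q + F(y)` (`q = p^e`): states `(F, r)`, one `step`
at the point `b` of the chart `y_j`, and the pair `(order, shade)`.  This file adds, at the same
statement level and in the SAME coordinates, the objects of the elimination approach of
Villamayor, Bravo–Villamayor and Benito–Villamayor for the Rees algebra `𝒢 = Diff(𝒪[f W^q])`,
`f = x^q + F(y)`, read through the transversal projection `β : (x, y) ↦ y`: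

* `WGen` — a weighted generator `g W^n` (`g ∈ k[y]`, weight `n ≥ 1`) of a Rees algebra over the
  base of the projection, with its normalised order `ν(g)/n` compared by cross-multiplication
  (`RatioLE / RatioGT`, no division);
* `freshGens q F` — the generators `(D^{(b)} F) W^{q−|b|}`, `1 ≤ |b| ≤ q − 1` (`D^{(b)}` the
  Hasse–Schmidt derivatives of `HasseSchmidtDerivatives`).  This is THIS TREE'S READING of the
  elimination algebra `ℛ_{𝒢,β}` for `f = x^q + F`: [Bravo–Villamayor 2010, ¶2.8–2.9] describe
  `ℛ_{𝒢,β}` as generated by the (weighted) coefficients of the characteristic polynomial of `fW^q`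
  and closed under the differential operators of the base; for the purely inseparable `x^q + F`
  the only non-trivial coefficient is `F W^q` and its `Diff`-closure over `k[y]` is generated, up to
  integral closure, by the `D^{(b)}F · W^{q−|b|}`.  The identification is a DERIVED reading (checked
  on [Bravo–Villamayor 2010, Example 5]: `x² + z⁴ + y⁷ + y⁴z²` in characteristic 2 gives
  `(z⁴ + y⁶)W` and, after the `y`-chart, `(y⁵ + y³z⁴)W` of order `5/2`, as printed), recorded as
  such in the atlas documentation; it is a definition here, never a cited theorem;
* `GensOrderLE / GensOrderGT 𝒢 a c` — "`ord(𝒢)(0) ≤ a/c`" / "`> a/c`" for the algebra generated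
  by `𝒢` (the order of a finitely generated Rees algebra at a point is `min ν(g)/n` over generators,
  [Encinas–Villamayor 2007, 3.8–3.9]);
* `transportGen j b` — the law of transformation of Rees algebras under the blow-up at a point of
  `Sing`: `g W^n ↦ (g^*/y_j^n) W^n` in the chart `y_j`, then translation to the point `b`
  [Benito–Villamayor 2013, 3.2 (ii)]; `ElimState` = a walk state together with the transported
  generators of `(ℛ_{𝒢,β})_r`, `eroot / estep` the walk;
* `IsBadPoint / IsGoodPoint` — [Benito–Villamayor 2012, Def. 4.2]: the closed point is *bad*
  ("purple") iff `H-ord^{(d−1)}(𝒢_r)(x) = ν(a_{p^e})/p^e < ord((ℛ_{𝒢,β})_r)(x)` and *good*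
  ("green") iff `H-ord = ord((ℛ_{𝒢,β})_r)`, where by [Benito–Villamayor 2013, Cor. 7.3]
  `H-ord^{(d−1)}(𝒢_r)(x) = min {ν(a_{p^e})/p^e, ord(ℛ_{𝒢,β})_r(x)}` in a well-adapted
  `p`-presentation `z^{p^e} + a_1 z^{p^e−1} + ⋯ + a_{p^e}`; for the cleaned `x^q + F` of the walk,
  `a_{p^e} = F` and the other `a_i` vanish;
* `MonomialWitness 𝒢 E` — a generator-level witness that the integral closure of the algebra of
  `𝒢` is the monomial algebra `y^α W` supported on the exceptional variables `E` (the "monomial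
  case" reached in [Benito–Villamayor 2013, 6.5, Prop. 6.6]); a SUFFICIENT condition, used by the
  atlas as a column;
* the edge predicate `IncreaseFromMonomialWitness` (a shade increase — a kangaroo point of
  `PointBlowupShade` — out of a state carrying a monomial witness), which the atlas counts.

They are PREDICATES on states and steps, never asserted.  The published theorems around them —
the sandwich `𝒢' ⊂ G(𝒢)' ⊂ G(𝒢')` of transforms and `Diff`-closures [Encinas–Villamayor 2007,
Thm. 4.1 (Giraud)], the stability of elimination algebras under transformation
[Bravo–Villamayor 2010, Thm. 1.6 / ¶2.7], the tight monomial algebra and the strong monomial case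
[Benito–Villamayor 2013, 7.4, (7.7.1), Def. 7.10, Thm. 7.11], and the decrease of the surface
invariant along bad hypersurfaces [Benito–Villamayor 2012, §4] — carry hypotheses (well-adapted
presentations, `e`, `τ_{𝒢} = 1`, the monomial case) whose identification with the walk's cleaned
coordinates is a recorded convention of the atlas, not a theorem of this file.  What is NOT here:
`τ`, the integer `e` and `H-ord` for a general Rees algebra, integral closures, the functions
`H-ord^{(d−e)}` in higher codimension, and any claim that an invariant decreases.  The computable
twin with kernel-checked rows is `KangarooAtlasCertElimination`.
-/

noncomputable section

open MvPolynomial Finset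

open scoped BigOperators

namespace Literature.AlgebraicGeometry.Resolution

open Literature.AlgebraicGeometry.Resolution.Hauser2010

namespace PointBlowup

variable {σ : Type*} {K : Type*} [CommRing K]

/-! ### Weighted generators and normalised orders -/

/-- A **weighted generator** `g W^n` of a Rees algebra `⊕ I_n W^n` over the base `k[y]` of the
projection. [cite: EncinasVillamayor2007, 1.5 (Rees algebras 𝒢 = ⊕ I_k W^k, generators g_i W^{n_i})] -/
structure WGen (σ : Type*) (K : Type*) [CommRing K] where
  /-- the element `g ∈ k[y]` -/
  g : MvPolynomial σ K
  /-- its weight `n` (`g ∈ I_n`) -/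
  n : ℕ

namespace WGen

/-- `ν(g)/n ≤ a/c`, cross-multiplied in `ℕ∞` (`ν = ord₀`; `g = 0` has `ν = ⊤`).
[cite: EncinasVillamayor2007, 3.8–3.9 (ord of a Rees algebra: min ν(g_i)/n_i)] -/
def RatioLE (G : WGen σ K) (a c : ℕ) : Prop :=
  (c : ℕ∞) * ordZero G.g ≤ ((a * G.n : ℕ) : ℕ∞)

/-- `ν(g)/n > a/c`, cross-multiplied in `ℕ∞`. [cite: EncinasVillamayor2007, 3.8–3.9] -/
def RatioGT (G : WGen σ K) (a c : ℕ) : Prop :=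
  ((a * G.n : ℕ) : ℕ∞) < (c : ℕ∞) * ordZero G.g

end WGen

/-- `ord(𝒢)(0) ≤ a/c` for the algebra generated by the weighted set `𝒢`: some generator has
normalised order `≤ a/c`. [cite: EncinasVillamayor2007, 3.8–3.9 (ord_x 𝒢 = min_i ν_x(g_i)/n_i)] -/
def GensOrderLE (𝒢 : Set (WGen σ K)) (a c : ℕ) : Prop :=
  ∃ G ∈ 𝒢, G.RatioLE a c

/-- `ord(𝒢)(0) > a/c`: every generator has normalised order `> a/c`.
[cite: EncinasVillamayor2007, 3.8–3.9] -/
def GensOrderGT (𝒢 : Set (WGen σ K)) (a c : ℕ) : Prop :=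
  ∀ G ∈ 𝒢, G.RatioGT a c

/-! ### The fresh elimination generators of `x^q + F(y)` -/

/-- The **fresh generator** `(D^{(b)} F) · W^{q − |b|}` attached to the multi-index `b`.
This tree's reading of the generators of `ℛ_{𝒢,β}`, `𝒢 = Diff(𝒪[(x^q + F)W^q])`, after
[cite: BravoVillamayor2010, ¶2.8–2.9 (ℛ_{𝒢,β}: coefficients of the characteristic polynomial, closed by Diff of the base)]. -/
def freshGen (q : ℕ) (F : MvPolynomial σ K) (b : σ →₀ ℕ) : WGen σ K :=
  ⟨hasseDeriv K b F, q - b.degree⟩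

/-- The **fresh generating set** `{(D^{(b)}F) W^{q−|b|} : 1 ≤ |b| ≤ q − 1}` at a root of the walk
(derived reading, see the module docstring; agrees with [cite: BravoVillamayor2010, Example 5]). -/
def freshGens (q : ℕ) (F : MvPolynomial σ K) : Set (WGen σ K) :=
  {G | ∃ b : σ →₀ ℕ, 0 < b.degree ∧ b.degree < q ∧ G = freshGen q F b}

/-! ### Transport along the walk -/

/-- **Transform of a weighted generator** under the point blow-up, chart `y_j`, point `b`:
`g W^n ↦ (g^* / y_j^n)(y + b) W^n` (total transform divided by the `n`-th power of the
exceptional equation, read at the point). [cite: BenitoVillamayoru2013, 3.2 (ii) (I_n 𝒪_{V₁} = I(H)^n I_n^{(1)})] -/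
def transportGen [DecidableEq σ] (j : σ) (b : σ → K) (G : WGen σ K) : WGen σ K :=
  ⟨translate b (chartTransform G.n j G.g), G.n⟩

/-- A walk state together with generators of the transported elimination algebra `(ℛ_{𝒢,β})_r`.
[cite: BenitoVillamayoru2013, 6.2 ((ℛ_{𝒢,β})_r, the transform of ℛ_{𝒢,β} to V_r^{(d−e)})] -/
structure ElimState (σ : Type*) (K : Type*) [CommRing K] where
  /-- Hauser's state `(F, r)` -/
  s : State σ K
  /-- generators of `(ℛ_{𝒢,β})_r` at the point -/
  gens : Set (WGen σ K)

/-- The root: `(F, r = 0)` with the fresh generators. [cite: BravoVillamayor2010, ¶2.8–2.9] -/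
def eroot (q : ℕ) (F : MvPolynomial σ K) : ElimState σ K :=
  ⟨⟨F, 0⟩, freshGens q F⟩

/-- One step: Hauser's `step` on `(F, r)` and the transport of every generator.
[cite: BenitoVillamayoru2013, 3.2 (ii)] [cite: Hauser2010, §§F–G (point blowup followed by cleaning)] -/
def estep [DecidableEq σ] [DecidableEq K] (q : ℕ) (j : σ) (b : σ → K) (es : ElimState σ K) :
    ElimState σ K :=
  ⟨step q j b es.s, transportGen j b '' es.gens⟩

/-! ### Colour of the point (Benito–Villamayor 2012) -/

/-- **Bad (purple) point**: `ν(F)/q < ord((ℛ_{𝒢,β})_r)` — by [cite: BenitoVillamayoru2013, Cor. 7.3]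
`H-ord = min{ν(a_{p^e})/p^e, ord(ℛ_{𝒢,β})_r}` with `a_{p^e} = F` for the cleaned `x^q + F`, so this is
`H-ord = ν(a_{p^e})/p^e < ord((ℛ_{𝒢,β})_r)`. [cite: BenitoVillamayoru2011, Def. 4.2 (bad point)] -/
def IsBadPoint (q : ℕ) (es : ElimState σ K) : Prop :=
  ∀ n : ℕ, ordZero es.s.F = n → GensOrderGT es.gens n q

/-- **Good (green) point**: `H-ord = ord((ℛ_{𝒢,β})_r)`, i.e. `ord((ℛ_{𝒢,β})_r) ≤ ν(F)/q`.
[cite: BenitoVillamayoru2011, Def. 4.2 (good point)] [cite: BenitoVillamayoru2013, Cor. 7.3] -/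
def IsGoodPoint (q : ℕ) (es : ElimState σ K) : Prop :=
  ∀ n : ℕ, ordZero es.s.F = n → GensOrderLE es.gens n q

/-! ### Monomial witness and the counted edge predicate -/

/-- A **monomial witness** for the weighted set `𝒢` on the exceptional variables `E`: a generator
`(y^d · u) W^n`, `u(0)` a unit, `supp d ⊆ E`, whose exponent ratios `d_i/n` bound below the
ratios `e_i/n'` of every monomial `y^e` of every generator `g' W^{n'}`.  Then the integral closure
of the `𝒪`-algebra of `𝒢` is that of the monomial algebra `y^{d/n} W`: the "monomial case"
`(ℛ_{𝒢,β})_r = I(H₁)^{α₁}⋯I(H_r)^{α_r} W^s` (up to integral closure) of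
[cite: BenitoVillamayoru2013, 6.5 and Prop. 6.6 (reduction to the monomial case)]; a sufficient test only. -/
def MonomialWitness (𝒢 : Set (WGen σ K)) (E : Finset σ) : Prop :=
  ∃ G ∈ 𝒢, ∃ d : σ →₀ ℕ, ∃ u : MvPolynomial σ K,
    0 < G.n ∧ d.support ⊆ E ∧ IsUnit (constantCoeff u) ∧ G.g = monomial d 1 * u ∧
      ∀ G' ∈ 𝒢, ∀ e ∈ G'.g.support, ∀ i, d i * G'.n ≤ G.n * e i

/-- The counted edge predicate: the step at the equimultiple point `b` of chart `y_j` is a shade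
increase (a kangaroo point of `PointBlowupShade`) although the transported elimination algebra at
the source carries a monomial witness on the exceptional variables `supp r`.
[cite: Hauser2010, §F (kangaroo points)] [cite: BenitoVillamayoru2013, 6.5 (monomial case)] -/
def IncreaseFromMonomialWitness [DecidableEq σ] [DecidableEq K] (q : ℕ) (j : σ) (b : σ → K)
    (es : ElimState σ K) : Prop :=
  MonomialWitness es.gens es.s.r.support ∧ IsKangarooPoint q j b es.s

/-- Bad excludes good (as soon as the generating set is non-empty, which a bad point with a
generator of finite order witnesses through `IsGoodPoint`'s own witness). [cite: BenitoVillamayoru2011, Def. 4.2] -/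
theorem not_isGoodPoint_of_isBadPoint (q : ℕ) (es : ElimState σ K) {n : ℕ}
    (hF : ordZero es.s.F = n) (hbad : IsBadPoint q es) : ¬ IsGoodPoint q es := by
  intro hgood
  obtain ⟨G, hG, hle⟩ := hgood n hF
  have hgt := hbad n hF G hG
  exact (lt_irrefl _) (lt_of_lt_of_le hgt hle)

end PointBlowup

end Literature.AlgebraicGeometry.Resolution

end
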